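import Mathlib.Algebra.Order.Floor.Defs
import Mathlib.Algebra.Order.Floor.Semiring
import Mathlib.Tactic
import Literature.Computability.Complexity.Promise
import Literature.Computability.Cryptography.ClassBQP
import Literature.Computability.Cryptography.ClassBQPProofs
import Literature.Computability.Cryptography.QuantumCircuitProofs
import Literature.Computability.Cryptography.QubitRegisterCliffordTProofs
import Literature.Computability.Cryptography.ShorProofs
import Summits.QuantumAdvantage.QuantumAdvantage.Statement
import HarnessLib

/-!
# SoloInformedPseudoDeterministicLift — the pseudo-deterministic lift for `BQP ⊄ BPP`

Solo seat `solo-QuantumAdvantage-informed` (ideation tier, summit-directed). New mathematics for the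
summit `QuantumAdvantage := ∃ L, L ∈ BQP ∧ L ∉ BPP`; nothing here is a reproduction.

**The line.** Write `Q-EXT := PromiseBQP ⊆ promiseLift BQP` ("every promise problem decided by a
uniform quantum circuit family on its promise is *solved* by some `BQP` language", Goldreich's notion
of a solution of a promise problem). Then

* `quantumAdvantage_of_promiseIsLift` (assembly): `Q-EXT ∧ ¬ (PromiseBQP ⊆ promiseLift BPP) → QuantumAdvantage`;
  the second hypothesis ("some `PromiseBQP` problem has no `BPP`-language solution") is weaker than the
  textbook promise separation `PromiseBQP ⊄ PromiseBPP'` (`PromiseBPP_subset_PromiseBPP'`).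
* `not_promiseBQP_subset_promiseP_of_not_promiseIsLift`: `¬ Q-EXT → ¬ (PromiseBQP ⊆ PromiseP)`, so
  `Q-EXT` is not cheaply refutable either (its negation already separates `PromiseBQP` from `PromiseP`).
* The *pseudo-deterministic reformulation* of `Q-EXT` (quantum analogue of Dixon–Pavan–Vander Woude–
  Vinodchandran, STOC 2022, Thm. 2.1 "APEP has a pseudodeterministic approximation algorithm iff
  PromiseBPP = BPP"): the class-agnostic core is proved here —
  `abs_gridCount_div_sub_le` (a family of threshold solutions on the grid `j/K` yields the CANONICAL
  estimate `#{j ≤ K : x ∈ L j}/K` of the acceptance probability, accurate to `2/K`) and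
  `thresholdSet_separates` (a canonical estimate accurate to `< η` solves every threshold promise
  problem with margin `η`), and the `BQP` direction "canonical `FBQP`-computable rounding bit ⇒ `Q-EXT`"
  is `promiseBQP_subset_promiseLift_of_canonicalBit`.

[cite: DixonPavanVanderWoudeVinodchandran2022, Thm. 2.1] [cite: Goldreich2006, Def. 1.2]
-/

noncomputable section

namespace Summit.QuantumAdvantage.QuantumAdvantage.Theorems

open _root_.Computability Literature.Computability.Complexity Literature.Computability.Cryptography

/-! ### Assembly: the promise-is-lift hypothesis decides the summit from a promise separation -/

/-- If every `PromiseBQP` problem is solved by a `BQP` language and `BQP ⊆ BPP`, then every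
`PromiseBQP` problem is solved by a `BPP` language (`PromiseBPP = promiseLift BPP`, the strong
promise class of the tree). [cite: Goldreich2006, Def. 1.2] -/
theorem promiseBQP_subset_promiseBPP_of_promiseIsLift
    (hExt : PromiseBQP ⊆ promiseLift BQP) (hBQP : BQP ⊆ BPP) :
    PromiseBQP ⊆ PromiseBPP :=
  hExt.trans (promiseLift_mono hBQP)

/-- **Assembly of the pseudo-deterministic lift.** If every `PromiseBQP` problem is solved by some
`BQP` language (`Q-EXT`) and some `PromiseBQP` problem is solved by no `BPP` language, then
`BQP ⊄ BPP`, i.e. the summit `QuantumAdvantage`. [cite: Goldreich2006, Def. 1.2] -/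
theorem quantumAdvantage_of_promiseIsLift
    (hExt : PromiseBQP ⊆ promiseLift BQP) (hSep : ¬ PromiseBQP ⊆ PromiseBPP) :
    QuantumAdvantage := by
  by_contra hQA
  apply hSep
  refine promiseBQP_subset_promiseBPP_of_promiseIsLift hExt fun L hL => ?_
  by_contra hLB
  exact hQA ⟨L, hL, hLB⟩

/-- The negation of `Q-EXT` is itself a separation: if some `PromiseBQP` problem has no
`BQP`-language solution then it has no `P`-language solution (`P ⊆ BQP`), i.e.
`PromiseBQP ⊄ PromiseP`. Uses the tree's discharged fact `P_subset_BQP_holds`. [cite: Goldreich2006, Def. 1.2] -/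
theorem not_promiseBQP_subset_promiseP_of_not_promiseIsLift
    (hnExt : ¬ PromiseBQP ⊆ promiseLift BQP) : ¬ PromiseBQP ⊆ PromiseP := fun h =>
  hnExt (h.trans (promiseLift_mono P_subset_BQP_holds))

/-- Dichotomy form: either `PromiseBQP ⊄ PromiseP` outright, or the summit follows from the
(weak) promise separation `¬ PromiseBQP ⊆ promiseLift BPP`. [cite: Goldreich2006, Def. 1.2] -/
theorem promiseSep_or_lift :
    (¬ PromiseBQP ⊆ PromiseP) ∨ (¬ PromiseBQP ⊆ PromiseBPP → QuantumAdvantage) := by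
  by_cases hExt : PromiseBQP ⊆ promiseLift BQP
  · exact Or.inr (quantumAdvantage_of_promiseIsLift hExt)
  · exact Or.inl (not_promiseBQP_subset_promiseP_of_not_promiseIsLift hExt)

/-! ### The class-agnostic core of the pseudo-deterministic reformulation -/

section Canonical

variable {X : Type*}

/-- **Canonical estimate from grid thresholds.** Let `p : X → [0,1]` and `K ≥ 1`, and suppose
that for every grid index `j` the set `L j` solves the threshold promise problem at `j/K` with
margin `1/K`: `p x ≥ (j+1)/K → x ∈ L j` and `p x ≤ (j-1)/K → x ∉ L j` (membership is arbitrary but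
FIXED in between). Then the canonical quantity `#{j ≤ K : x ∈ L j} / K` is within `2/K` of `p x`.
This is the combinatorial heart of "promise problems have language solutions ⇒ a pseudo-
deterministic approximation of the acceptance probability" (the value depends only on the fixed
languages `L j`, not on any randomness). [cite: DixonPavanVanderWoudeVinodchandran2022, Thm. 2.1 (proof, ⇐)] -/
theorem abs_gridCount_div_sub_le (p : X → ℝ) (hp0 : ∀ x, 0 ≤ p x) (hp1 : ∀ x, p x ≤ 1)
    {K : ℕ} (hK : 0 < K) (L : ℕ → Set X)
    (hyes : ∀ (j : ℕ) (x : X), ((j : ℝ) + 1) / K ≤ p x → x ∈ L j)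
    (hno : ∀ (j : ℕ) (x : X), p x ≤ ((j : ℝ) - 1) / K → x ∉ L j)
    (x : X) [DecidablePred fun j => x ∈ L j] :
    |(((Finset.range (K + 1)).filter fun j => x ∈ L j).card : ℝ) / K - p x| ≤ 2 / K := by
  have hKr : (0 : ℝ) < K := by exact_mod_cast hK
  set c := ((Finset.range (K + 1)).filter fun j => x ∈ L j).card with hc
  -- `m = ⌊K · p x⌋`, so `m ≤ K p x < m + 1` and `m ≤ K`.
  set m := ⌊(K : ℝ) * p x⌋₊ with hm
  have hKp0 : 0 ≤ (K : ℝ) * p x := mul_nonneg hKr.le (hp0 x)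
  have hm_le : (m : ℝ) ≤ K * p x := Nat.floor_le hKp0
  have hm_lt : (K : ℝ) * p x < m + 1 := Nat.lt_floor_add_one _
  have hmK : m ≤ K := by
    have : (m : ℝ) ≤ K := hm_le.trans (by nlinarith [hp1 x])
    exact_mod_cast this
  -- lower bound: every `j < m` has `(j+1)/K ≤ m/K ≤ p x`, hence `x ∈ L j`.
  have hlow : m ≤ c := by
    have hsub : Finset.range m ⊆ (Finset.range (K + 1)).filter fun j => x ∈ L j := by
      intro j hj
      rw [Finset.mem_range] at hj
      rw [Finset.mem_filter, Finset.mem_range]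
      refine ⟨by omega, hyes j x ?_⟩
      rw [div_le_iff₀ hKr]
      have hj' : j + 1 ≤ m := Nat.succ_le_of_lt hj
      have : (j : ℝ) + 1 ≤ m := by exact_mod_cast hj'
      nlinarith
    simpa using Finset.card_le_card hsub
  -- upper bound: every `j` with `x ∈ L j` has `p x > (j-1)/K`, hence `j - 1 < K p x < m + 1`.
  have hupp : c ≤ m + 2 := by
    have hsub : ((Finset.range (K + 1)).filter fun j => x ∈ L j) ⊆ Finset.range (m + 2) := by
      intro j hj
      rw [Finset.mem_filter] at hj
      rw [Finset.mem_range]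
      have hlt : ((j : ℝ) - 1) / K < p x := lt_of_not_ge fun h => hno j x h hj.2
      rw [div_lt_iff₀ hKr] at hlt
      have : (j : ℝ) - 1 < m + 1 := by linarith
      have : (j : ℝ) < m + 2 := by linarith
      exact_mod_cast this
    simpa using Finset.card_le_card hsub
  have hlow' : (m : ℝ) ≤ c := by exact_mod_cast hlow
  have hupp' : (c : ℝ) ≤ m + 2 := by exact_mod_cast hupp
  have key : |(c : ℝ) - K * p x| ≤ 2 := by
    rw [abs_le]; constructor <;> linarith
  have hrw : (c : ℝ) / K - p x = ((c : ℝ) - K * p x) / K := by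
    field_simp
  rw [hrw, abs_div, abs_of_pos hKr]
  exact div_le_div_of_nonneg_right key hKr.le

/-- **A canonical estimate solves every threshold promise problem.** If `v` is within `< η` of `p`
everywhere, then for thresholds `a ≥ t + η` and `b ≤ t - η` the FIXED set `{x | t ≤ v x}` contains
every `x` with `p x ≥ a` and no `x` with `p x ≤ b`. [cite: DixonPavanVanderWoudeVinodchandran2022, Thm. 2.1 (proof, ⇒)] -/
theorem thresholdSet_separates (p v : X → ℝ) {η : ℝ} (hv : ∀ x, |v x - p x| < η)
    {a b t : ℝ} (ha : t + η ≤ a) (hb : b ≤ t - η) :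
    {x | a ≤ p x} ⊆ {x | t ≤ v x} ∧ {x | p x ≤ b} ⊆ {x | t ≤ v x}ᶜ := by
  constructor
  · intro x hx
    have h := (abs_lt.mp (hv x)).1
    simp only [Set.mem_setOf_eq] at hx ⊢
    linarith
  · intro x hx hx'
    have h := (abs_lt.mp (hv x)).2
    simp only [Set.mem_setOf_eq] at hx hx'
    linarith

end Canonical

/-! ### The `BQP` direction: a canonical quantum rounding bit gives `Q-EXT` -/

/-- **Pseudo-deterministic estimation ⇒ promise problems have `BQP`-language solutions.** Suppose
that for every poly-time uniform, oracle-free Clifford+T family `F` there is a CANONICAL real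
estimate `v` of its acceptance probability, accurate to `< 1/6` on every input, whose rounding bit
`[v x ≥ 1/2]` is written on wire `0` with probability `≥ 2/3` by some uniform oracle-free family
(i.e. the bit is an `FBQP` function of `x` — a pseudo-deterministic quantum algorithm). Then every
`PromiseBQP` problem is solved by a `BQP` language, namely `{x | 1/2 ≤ v x}`. Uses the tree's
`mem_BQP_of_isQSolvable_bit` with the discharged facts `QCircuit.outputPMF_apply_holds`,
`cliffordT_isUnitary_holds`. [cite: DixonPavanVanderWoudeVinodchandran2022, Thm. 2.1 (⇒, quantum analogue)] -/
theorem promiseBQP_subset_promiseLift_of_canonicalBit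
    (h : ∀ F : QCircuitFamily cliffordT, F.IsOracleFree → F.IsUniform →
      ∃ (v : List Bool → ℝ) (bit : List Bool → Bool),
        (∀ x, |v x - F.acceptProbOn 0 x| < 1 / 6) ∧ (∀ x, bit x = true ↔ 1 / 2 ≤ v x) ∧
        IsQSolvable fun x => {z | [bit x] <+: z}) :
    PromiseBQP ⊆ promiseLift BQP := by
  intro Q hQ
  obtain ⟨F, hF, hU, hyes, hno⟩ := hQ
  obtain ⟨v, bit, hv, hbit, hsolv⟩ := h F hF hU
  have hL : {x | 1 / 2 ≤ v x} ∈ BQP :=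
    mem_BQP_of_isQSolvable_bit (fun _ _ => QCircuit.outputPMF_apply_holds) cliffordT_isUnitary_holds
      (L := {x | 1 / 2 ≤ v x}) (bit := bit)
      (fun x => show (bit x = true ↔ x ∈ {x | (1 : ℝ) / 2 ≤ v x}) from hbit x) hsolv
  have hsep := thresholdSet_separates (fun x => F.acceptProbOn 0 x) v hv
    (a := 2 / 3) (b := 1 / 3) (t := 1 / 2) (by norm_num) (by norm_num)
  exact ⟨{x | 1 / 2 ≤ v x}, hL, fun x hx => hsep.1 (hyes x hx), fun x hx => hsep.2 (hno x hx)⟩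

end Summit.QuantumAdvantage.QuantumAdvantage.Theorems

end
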